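import Literature.Computability.AlgebraicComplexity.FSV18CommROABPThm43
import Literature.Computability.AlgebraicComplexity.FSV18Lemma40Proofs
import HarnessLib

/-!
# FSV 2018 §5.3, commutative roABPs: Thm. 43, Cor. 44 and the commutative-roABP conjunct of Thm. 9
# are now theorems (join of the Lemma 40 discharge with the printed reductions)

M. Forbes, A. Shpilka, B. L. Volk, *Succinct hitting sets and barriers to proving lower bounds for
algebraic circuits*, Theory Comput. 14 (2018) = arXiv:1701.05328 [ForbesShpilkaVolk2018], §5.3
(seq. Thm. 43 = ToC Thm. 5.19, Cor. 44 = ToC Cor. 5.20, Thm. 9's conjunct for commutative roABPs =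
ToC Thm. 1.10). The named facts `FSV2018_thm43`, `FSV2018_cor44`, `FSV2018_thm9_commROABP` of
`FSV18SuccinctGenerators.lean` were reduced in the tree to `FSV2018_lemma40` along the printed
proofs (`FSV2018_thm43_of_lemma40` in `FSV18CommROABPThm43.lean`; `FSV2018_cor44_of_thm43`,
`FSV2018_thm9_commROABP_of_cor44` in `FSV18SuccinctGenerators.lean`); with `FSV2018_lemma40_holds`
(`FSV18Lemma40Proofs.lean`, = [FSS14, Thm. 28]) all three are discharged here BY NAME. Join file:
neither of the two imported files imports the other. No statements, no facts; nothing here bears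
on `VP ≠ VNP`.
-/

namespace Literature.Computability.AlgebraicComplexity

/-- **FSV Thm. 43 (ToC Thm. 5.19) — DISCHARGED:** "Let `|𝔽| > nd`, and let `F(X)` be an
`N`-variate polynomial of individual degree at most `d`, computed by a width-`w` commutative
roABP. Then `F ≢ 0` iff `F ∘ G^{SSV}_{n,1+4 log w} ≢ 0`" — from Lemma 40 (proved) by the printed
reduction `FSV2018_thm43_of_lemma40`.
[cite: ForbesShpilkaVolk2018, Thm. 43 (seq.) = ToC Thm. 5.19, p. 28–29] -/
theorem FSV2018_thm43_holds : FSV2018_thm43 :=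
  FSV2018_thm43_of_lemma40 FSV2018_lemma40_holds

/-- **FSV Cor. 44 (ToC Cor. 5.20) — DISCHARGED:** "There exists a `poly(n, log(w))`-`ΣΠΣ` succinct
generator for the class of polynomials computed by width-`w` commutative roABPs" — from Thm. 43 by
the printed reduction `FSV2018_cor44_of_thm43`.
[cite: ForbesShpilkaVolk2018, Cor. 44 (seq.) = ToC Cor. 5.20, p. 29] -/
theorem FSV2018_cor44_holds : FSV2018_cor44 :=
  FSV2018_cor44_of_thm43 FSV2018_thm43_holds

/-- **FSV Thm. 9 (ToC Thm. 1.10), conjunct "commutative roABPs" — DISCHARGED:** the succinct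
hitting set statement of Thm. 9 for the class of width-`w` commutative roABPs, from Cor. 44 by the
printed reduction `FSV2018_thm9_commROABP_of_cor44`.
[cite: ForbesShpilkaVolk2018, Thm. 9 (seq.) = ToC Thm. 1.10, p. 11] -/
theorem FSV2018_thm9_commROABP_holds : FSV2018_thm9_commROABP :=
  FSV2018_thm9_commROABP_of_cor44 FSV2018_cor44_holds

end Literature.Computability.AlgebraicComplexity
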